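import Literature.Probability.HypothesisTesting.UniformityTestingLowerBound
import Mathlib.Analysis.SpecialFunctions.Pow.Real
import Mathlib.Analysis.SpecialFunctions.Pow.Continuity
import Mathlib.Topology.Order.IntermediateValue
import Mathlib.Topology.Algebra.Order.Field
import Mathlib.Data.Fin.Tuple.Sort
import Mathlib.Logic.Equiv.Fin.Basic
import HarnessLib

/-!
# Valiant–Valiant's instance-optimal lower bound for identity testing (the `‖p^{−max}_{−ϵ}‖_{2/3}/ϵ²` law)

Topic `Literature/Probability/HypothesisTesting` (sibling of `UniformityTestingLowerBound.lean`, whose Le Cam +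
Ingster machinery it extends from the flat target to an ARBITRARY target; serves the pub-qadeq lane through
`Literature/Computability/QuantumComplexity/CertificationSampleComplexity.lean`, whose certification lower
bounds (Hangleiter–Kliesch–Eisert–Gogolin, Theorem 7) take exactly this theorem — their Theorem 2, lower
half — as the hypothesis `VVLowerBoundAt`).

HONEST FRAMING (pub-qadeq): instance-level adjudication of specific advantage claims; no claim about BQP
vs BPP or the summit.  This file is classical distribution-testing mathematics (finite sums, Cauchy–Schwarz,
`cosh b ≤ e^{b²/2}`, the intermediate value theorem) and asserts nothing about any device.

## Source, verbatim (held text: ECCC TR13-111 = `paper:url-5190f89d2f0a`, 42 pp.; the SIAM J. Comput.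
version of record is [ValiantValiant2017])

G. Valiant, P. Valiant, *An Automatic Inequality Prover and Instance Optimal Identity Testing*, FOCS 2014;
SIAM J. Comput. 46 (2017) 429–455; ECCC TR13-111.

* Theorem 1 (p. 5 of the ECCC text): “There exist constants `c₁, c₂` such that for any `ϵ > 0` and any known
  distribution `p`, for any unknown distribution `q`, our tester will distinguish `q = p` from `‖p − q‖₁ ≥ ϵ`
  with probability `2/3` when run on a set of at least `c₁ max{1/ϵ, ‖p^{−max}_{−ϵ/16}‖_{2/3}/ϵ²}` samples …
  and no tester can do this task with probability at least `2/3` with a set of fewer than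
  `c₂ max{1/ϵ, ‖p^{−max}_{−ϵ}‖_{2/3}/ϵ²}` samples.”
* §3, Theorem 3 (pp. 8–9): “Given a distribution `p`, and associated values `ϵ_i` such that `ϵ_i ∈ [0, p_i]`,
  define the distribution over distributions `Q_ϵ` by the process: for each domain element `i`, randomly
  choose `q_i = p_i ± ϵ_i`, and then normalize `q` to be a distribution. There exists a constant `c` such
  that it takes at least `c (Σ_i ϵ_i⁴/p_i²)^{−1/2}` samples to distinguish `p` from `Q_ϵ` with success
  probability `2/3`. Further, with probability at least `1/2`, the L1 distance between a random
  distribution from `Q_ϵ` and `p` is at least `min{(Σ_i ϵ_i) − max_i ϵ_i, ½ Σ_i ϵ_i}`.”  (Proved there by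
  Poissonization and the subadditivity of the squared Hellinger distance, Lemma 2.)
* §3, Corollary 1 (p. 10): “… there is no tester that, via a set of
  `c′·(Σ_{i≠m} min{p_i, αp_i^{2/3}}⁴/p_i²)^{−1/2}` samples can distinguish `p` from distributions with L1
  distance `½ Σ_{i≠m} min{p_i, αp_i^{2/3}}` from `p` with probability `0.6`, where `m` is the index of the
  element of `p` with maximum probability.”  Proof: “letting `ϵ_i = min{p_i, αp_i^{2/3}}` for `i ≠ m` …”.
* §3, Proposition 2 (p. 10): “There exists a constant `c₂` such that for any `ϵ ∈ (0, 1)` and any known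
  distribution `p`, no tester can distinguish for an unknown distribution `q` whether `q = p` or
  `‖p − q‖₁ ≥ ϵ` with probability `≥ 2/3` when given a set of samples of size `c₂ ‖p^{−max}_{−ϵ}‖_{2/3}/ϵ²`.”
  Proof: “consider the value of `α` for which `½ Σ_{i≠m} min{p_i, αp_i^{2/3}} = ϵ`, and let `s` be the
  largest integer such that `Σ_{i<s} p_i ≤ ϵ`, where we assume `p_i` is sorted in ascending order. We note
  that for `i ≥ s` the min is never `p_i`, or else (since `p_i` are sorted in ascending order and the
  inequality `p_i ≤ αp_i^{2/3}` gets stronger for smaller `p_i`), the sum would be at least `Σ_{i≤s} p_i` …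
  Thus `α Σ_{i=s}^{m−1} p_i^{2/3} = Σ_{i=s}^{m−1} min{p_i, αp_i^{2/3}} ≤ Σ_{i≠m} min{p_i, αp_i^{2/3}} = 2ϵ` …
  (since the min of two quantities can only increase if we replace one by a weighted geometric mean of both
  of them) … `≥ (c′/4)·‖p^{−max}_{≥s}‖_{2/3}/ϵ²`.”
* Hangleiter–Kliesch–Eisert–Gogolin restate the two halves as their Theorem 2 with the trimming of the lower
  bound at `2ϵ` (`‖P^{−max}_{−2ϵ}‖_{2/3}`) — the threshold the printed proof of Proposition 2 actually uses
  (total perturbation `Σ_{i≠m} min{p_i, αp_i^{2/3}} = 2ϵ`); this file proves that version.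

## What is formalised (all proved, 0 named facts, explicit constants) — and how the proof differs

The STATEMENTS are the source's; the indistinguishability step is proved by the Le Cam + Ingster (χ²)
method of the tree's `UniformityTestingLowerBound.lean` [Canonne2020, App. E.2] instead of the source's
Poissonization + Hellinger route (Lemma 2), applied to Valiant–Valiant's family `Q_ϵ` realised in CANCELLING
PAIRS: the sample space is sorted by probability and cut into consecutive pairs, pair `j` is perturbed by
`(+σ_j δ_j, −σ_j δ_j)` with `δ_j = min{p, αp^{2/3}}` of its smaller member, so every `Q_z` is a probability
vector (no “and then normalize”) at ℓ₁-distance exactly `2Σ_j δ_j` (no “with probability at least 1/2”).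
Everything else — the magnitudes `ϵ_i = min{p_i, αp_i^{2/3}}`, the choice of `α`, the trimming index and the
monotonicity argument, the estimate `Σ min{…}⁴/p_i² ≤ α³ Σ min{…}` — follows Proposition 2 verbatim.

* §1 `PairSpace J R = (Fin J × Bool) ⊕ R`, `rel` (`g_z`), `pert` (`Q_z = P(1 + g_z)`), `cc`
  (`c_j = δ_j²/P(j,0) + δ_j²/P(j,1)`); `pert_nonneg`, `sum_pert`, **`l1_pert`** (`‖Q_z − P‖₁ = 2Σδ_j`),
  **`overlap`** (`Σ_x P(1+g_z)(1+g_{z'}) = ΣP + Σ_j σ_jσ'_j c_j`).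
* §2 `l1_sq_le_sum_mul_sq_sub_one` (χ² step with a likelihood ratio: `‖p − pR‖₁² ≤ Σ pR² − 1`); the mixture
  `mixW = P^{⊗s}·ratio`, **Ingster's identity** `sum_prodW_mul_ratio_sq`, the pairwise `cosh` computation
  `sum_sum_exp_sum_mul_sgn` (`Σ_{z,z'} e^{Σ_j b_jσ_jσ'_j} = 2^J Π_j 2cosh b_j`), **`sum_prodW_mul_ratio_sq_le`**
  (`Σ P^{⊗s} ratio² ≤ Π_j cosh(s c_j) ≤ exp(s² Σ_j c_j²/2)`).
* §3 **Theorem 3, paired form**: `accept_sub_avg_le` (`𝔼_P[φ] − avg_z 𝔼_{Q_z}[φ] ≤ ½√(exp(s²Σc_j²/2) − 1)` for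
  every `[0,1]`-valued `φ`) and its tester form **`samples_sq_mul_sum_cc_sq_gt`** (`2/3`-completeness on `P`
  and `< 1/3` acceptance on every `Q_z` force `s² Σ_j c_j² > 8/13`).
* §4 `vvWeight α p = min{p, αp^{2/3}}` with Corollary 1's estimate **`vvWeight_pow_four_div_sq_le`**
  (`ϵ⁴/p² ≤ α³ϵ`) and Proposition 2's monotonicity step **`vvWeight_eq_self`** (the power branch, once
  inactive at `p`, is inactive below `p`), continuity in `α`.
* §5 **Proposition 2 = Theorem 1 (lower bound), explicit form `vv_lower_bound_enum`**: for a probability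
  vector enumerated in ascending order `p_0 ≤ ⋯ ≤ p_{n−1}` by `x : Fin n ≃ E`, `ϵ > 0`, and an index `t ≤ n−2`
  with `Σ_{k≤t} p_k > 2ϵ`, every test with `2/3`-completeness on `P` and `< 1/3` acceptance on every `Q`
  with `‖P − Q‖₁ > ϵ` has `(Σ_{t≤k≤n−2} p_k^{2/3})³ < 104 s² ϵ⁴`, i.e. `s > ‖(p_t, …, p_{n−2})‖_{2/3}/(√104 ϵ²)`
  (`c₂ = 1/√104 ≈ 0.098` for this branch; the `1/ϵ` branch of Theorem 1 is the tree's
  `Certification.certification_needs_inv_eps`).  The packaging as Hangleiter et al.'s `VVLowerBoundAt` —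
  `P^{−max}_{−2ϵ}` as a sorted list — is done in `CertificationSampleComplexity.lean` (v11).

NOT formalised: the upper-bound half of Theorem 1 (the source's §2 tester and §4–5 inequality prover);
the Poissonized/Hellinger form of Theorem 3 and Lemma 2 as printed (replaced as described); the `0.6`/`0.7`
amplification bookkeeping of Corollary 1 (unnecessary: the distance of `Q_z` from `P` is deterministic here).

## References

* [ValiantValiant2017] G. Valiant, P. Valiant, *An automatic inequality prover and instance optimal identity
  testing*, SIAM J. Comput. 46(1), 429–455 (2017), doi:10.1137/151002526 (FOCS 2014; ECCC TR13-111) —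
  Thm. 1 (lower bound), §3 Thm. 3, Cor. 1, Prop. 2 (ECCC pp. 8–10).
* [Canonne2020] C. L. Canonne, *A Survey on Distribution Testing: Your Data is Big. But is it Blue?*,
  Theory of Computing Graduate Surveys 9 (2020) — §5.1 and App. E.2 (Le Cam's method, Thm. E.7 / Cor. E.8;
  the Ingster-type χ² computation), through the tree's `UniformityTestingLowerBound.lean`.
* [Paninski2008] L. Paninski, *A coincidence-based test for uniformity given very sparsely sampled discrete
  data*, IEEE Trans. Inform. Theory 54 (2008) 4750–4755 — the paired construction in the flat case.
* [HangleiterEtAl2019] D. Hangleiter, M. Kliesch, J. Eisert, C. Gogolin, Phys. Rev. Lett. 122, 210502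
  (2019), arXiv:1812.01023 — Theorem 2 (the restatement with `‖P^{−max}_{−2ϵ}‖_{2/3}` that is packaged
  downstream).
-/

noncomputable section

open Finset Real

namespace Literature.Probability.HypothesisTesting

namespace IdentityTesting

open UniformityTesting

/-! ### §1. The paired perturbation family on a sample space with `J` marked pairs -/

/-- A sample space with `J` marked (disjoint) pairs of points `(j, false), (j, true)` and a rest `R`:
the shape on which Valiant–Valiant's random perturbation `q_i = p_i ± ϵ_i` is realised here in
CANCELLING PAIRS (`+σ_j δ_j` on `(j,false)`, `−σ_j δ_j` on `(j,true)`), so that every perturbed vector is a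
probability vector without the normalisation step of the source. [cite: ValiantValiant2017, §3 Thm. 3 (“for each domain element i, randomly choose q_i = p_i ± ϵ_i, and then normalize q to be a distribution”), ECCC TR13-111 p. 8–9] -/
abbrev PairSpace (J : ℕ) (R : Type*) := (Fin J × Bool) ⊕ R

variable {J : ℕ} {R : Type*}

section family

variable (P : PairSpace J R → ℝ) (δ : Fin J → ℝ)

/-- The relative perturbation `g_z(x) = (Q_z(x) − P(x))/P(x)`: `±δ_j/P` on the two points of pair `j`
(sign `σ(z_j)σ(c)`), `0` on the rest. [cite: ValiantValiant2017, §3 Thm. 3 (the family Q_ϵ), ECCC TR13-111 p. 8–9] -/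
def rel (z : Fin J → Bool) : PairSpace J R → ℝ
  | Sum.inl (j, c) => sgn (z j) * sgn c * δ j / P (Sum.inl (j, c))
  | Sum.inr _ => 0

/-- **The perturbed probability vector** `Q_z = P·(1 + g_z)`, i.e. `Q_z(j, c) = P(j, c) + σ(z_j)σ(c)δ_j` on the
pairs and `Q_z = P` on the rest (`z ∈ {0,1}^J` the random signs). [cite: ValiantValiant2017, §3 Thm. 3 (“randomly choose q_i = p_i ± ϵ_i”), ECCC TR13-111 p. 8–9] -/
def pert (z : Fin J → Bool) (x : PairSpace J R) : ℝ := P x * (1 + rel P δ z x)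

/-- The pair functional `c_j = δ_j²/P(j,false) + δ_j²/P(j,true)` — the summand `ϵ_i⁴/p_i²` of the source's
sample bound appears below as `c_j²`. [cite: ValiantValiant2017, §3 Thm. 3 (“at least c(Σ_i ϵ_i⁴/p_i²)^{−1/2} samples”), ECCC TR13-111 p. 9] -/
def cc (j : Fin J) : ℝ := δ j ^ 2 / P (Sum.inl (j, false)) + δ j ^ 2 / P (Sum.inl (j, true))

/-- Plumbing about `sgn`. [folklore] -/
private theorem sgn_mul_sgn (b : Bool) : sgn b * sgn b = 1 := by cases b <;> simp [sgn]

/-- Plumbing about `sgn`. [folklore] -/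
private theorem abs_sgn_eq (b : Bool) : |sgn b| = 1 := by cases b <;> simp [sgn]

/-- Plumbing about `sgn`. [folklore] -/
private theorem sgn_xor_eq (a b : Bool) : sgn (xor a b) = sgn a * sgn b := by
  cases a <;> cases b <;> simp [sgn]

/-- `p·(u/p)·(v/p) = uv/p` with the convention `x/0 = 0` (plumbing). [folklore] -/
private theorem mul_div_mul_div_self (p u v : ℝ) : p * (u / p) * (v / p) = u * v / p := by
  by_cases h : p = 0
  · simp [h]
  · field_simp

variable {P δ}

/-- On a pair point the absolute perturbation is `P·g_z = σ(z_j)σ(c)δ_j` (also when `P(j,c) = 0`, where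
`δ_j = 0`). [cite: ValiantValiant2017, §3 Thm. 3 (“ϵ_i ∈ [0, p_i]”), ECCC TR13-111 p. 8] -/
theorem mul_rel_inl (hδ0 : ∀ j, 0 ≤ δ j) (hδ : ∀ j c, δ j ≤ P (Sum.inl (j, c)))
    (z : Fin J → Bool) (j : Fin J) (c : Bool) :
    P (Sum.inl (j, c)) * rel P δ z (Sum.inl (j, c)) = sgn (z j) * sgn c * δ j := by
  simp only [rel]
  by_cases h : P (Sum.inl (j, c)) = 0
  · have hδj : δ j = 0 := le_antisymm (h ▸ hδ j c) (hδ0 j)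
    simp [h, hδj]
  · field_simp

/-- `|g_z| ≤ 1` (because `ϵ_i ≤ p_i`). [cite: ValiantValiant2017, §3 Thm. 3 (“ϵ_i ∈ [0, p_i]”), ECCC TR13-111 p. 8] -/
theorem abs_rel_le_one (hP0 : ∀ x, 0 ≤ P x) (hδ0 : ∀ j, 0 ≤ δ j)
    (hδ : ∀ j c, δ j ≤ P (Sum.inl (j, c))) (z : Fin J → Bool) (x : PairSpace J R) :
    |rel P δ z x| ≤ 1 := by
  rcases x with ⟨j, c⟩ | r
  · simp only [rel]
    by_cases h : P (Sum.inl (j, c)) = 0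
    · simp [h]
    · have hPpos : 0 < P (Sum.inl (j, c)) := lt_of_le_of_ne (hP0 _) (Ne.symm h)
      rw [abs_div, abs_mul, abs_mul, abs_sgn_eq, abs_sgn_eq, one_mul, one_mul,
        abs_of_nonneg (hδ0 j), abs_of_pos hPpos, div_le_one hPpos]
      exact hδ j c
  · simp [rel]

/-- `1 + g_z ≥ 0` (plumbing form of `|g_z| ≤ 1`). [cite: ValiantValiant2017, §3 Thm. 3, ECCC TR13-111 p. 8] -/
theorem one_add_rel_nonneg (hP0 : ∀ x, 0 ≤ P x) (hδ0 : ∀ j, 0 ≤ δ j)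
    (hδ : ∀ j c, δ j ≤ P (Sum.inl (j, c))) (z : Fin J → Bool) (x : PairSpace J R) :
    0 ≤ 1 + rel P δ z x := by
  have h := abs_rel_le_one hP0 hδ0 hδ z x
  rw [abs_le] at h
  linarith [h.1]

/-- **`Q_z ≥ 0`.** [cite: ValiantValiant2017, §3 Thm. 3 (Q_ϵ is a distribution over distributions), ECCC TR13-111 p. 8] -/
theorem pert_nonneg (hP0 : ∀ x, 0 ≤ P x) (hδ0 : ∀ j, 0 ≤ δ j)
    (hδ : ∀ j c, δ j ≤ P (Sum.inl (j, c))) (z : Fin J → Bool) (x : PairSpace J R) :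
    0 ≤ pert P δ z x :=
  mul_nonneg (hP0 x) (one_add_rel_nonneg hP0 hδ0 hδ z x)

/-- `Q_z(j, c) = P(j, c) + σ(z_j)σ(c)δ_j` — “`q_i = p_i ± ϵ_i`”. [cite: ValiantValiant2017, §3 Thm. 3, ECCC TR13-111 p. 8] -/
theorem pert_inl (hδ0 : ∀ j, 0 ≤ δ j) (hδ : ∀ j c, δ j ≤ P (Sum.inl (j, c)))
    (z : Fin J → Bool) (j : Fin J) (c : Bool) :
    pert P δ z (Sum.inl (j, c)) = P (Sum.inl (j, c)) + sgn (z j) * sgn c * δ j := by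
  unfold pert
  rw [mul_add, mul_one, mul_rel_inl hδ0 hδ]

/-- `Q_z = P` off the pairs. [cite: ValiantValiant2017, §3 Thm. 3, ECCC TR13-111 p. 8] -/
theorem pert_inr (z : Fin J → Bool) (r : R) : pert P δ z (Sum.inr r) = P (Sum.inr r) := by
  simp [pert, rel]

end family

section sums

variable [Fintype R] {P : PairSpace J R → ℝ} {δ : Fin J → ℝ}

/-- Sums over the pair space split into the pairs and the rest (plumbing). [folklore] -/
private theorem sum_pairSpace (f : PairSpace J R → ℝ) :
    ∑ x, f x = ∑ j, (f (Sum.inl (j, false)) + f (Sum.inl (j, true))) + ∑ r, f (Sum.inr r) := by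
  rw [Fintype.sum_sum_type, Fintype.sum_prod_type]
  congr 1
  exact sum_congr rfl fun j _ => by rw [Fintype.sum_bool, add_comm]

/-- The perturbation has zero total mass: `Σ_x P(x) g_z(x) = 0` (the two points of a pair cancel) — this
replaces the source's “and then normalize q to be a distribution”. [cite: ValiantValiant2017, §3 Thm. 3 (normalisation step), ECCC TR13-111 p. 8–9] -/
theorem sum_mul_rel (hδ0 : ∀ j, 0 ≤ δ j) (hδ : ∀ j c, δ j ≤ P (Sum.inl (j, c)))
    (z : Fin J → Bool) : ∑ x, P x * rel P δ z x = 0 := by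
  rw [sum_pairSpace]
  have hinr : ∀ r : R, P (Sum.inr r) * rel P δ z (Sum.inr r) = 0 := fun r => by simp [rel]
  simp only [mul_rel_inl hδ0 hδ, hinr, sum_const_zero, add_zero]
  refine sum_eq_zero fun j _ => ?_
  simp [sgn]

/-- **`Q_z` is a probability vector** (`Σ Q_z = Σ P`). [cite: ValiantValiant2017, §3 Thm. 3, ECCC TR13-111 p. 8] -/
theorem sum_pert (hδ0 : ∀ j, 0 ≤ δ j) (hδ : ∀ j c, δ j ≤ P (Sum.inl (j, c)))
    (z : Fin J → Bool) : ∑ x, pert P δ z x = ∑ x, P x := by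
  unfold pert
  simp_rw [mul_add, mul_one]
  rw [sum_add_distrib, sum_mul_rel hδ0 hδ, add_zero]

/-- **Each `Q_z` is exactly `2Σ_j δ_j`-far from `P` in `ℓ₁`** (deterministically — the source's “with
probability at least 1/2, the L1 distance … is at least min{(Σ_i ϵ_i) − max_i ϵ_i, ½Σ_i ϵ_i}” is not needed
for cancelling pairs). [cite: ValiantValiant2017, §3 Thm. 3 (distance clause), ECCC TR13-111 p. 9] -/
theorem l1_pert (hδ0 : ∀ j, 0 ≤ δ j) (hδ : ∀ j c, δ j ≤ P (Sum.inl (j, c)))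
    (z : Fin J → Bool) : ∑ x, |pert P δ z x - P x| = 2 * ∑ j, δ j := by
  have h : ∀ x, pert P δ z x - P x = P x * rel P δ z x := fun x => by unfold pert; ring
  simp_rw [h]
  rw [sum_pairSpace]
  have hinr : ∀ r : R, |P (Sum.inr r) * rel P δ z (Sum.inr r)| = 0 := fun r => by simp [rel]
  simp only [mul_rel_inl hδ0 hδ, hinr, sum_const_zero, add_zero]
  simp only [abs_mul, abs_sgn_eq, one_mul]
  rw [mul_sum]
  refine sum_congr rfl fun j _ => ?_
  rw [abs_of_nonneg (hδ0 j)]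
  ring

/-- **The pair overlap**: `Σ_x P(x)(1 + g_z(x))(1 + g_{z'}(x)) = Σ_x P(x) + Σ_j σ(z_j)σ(z'_j) c_j` — the
quantity whose `s`-th power Ingster's method averages. [cite: ValiantValiant2017, §3 Thm. 3 (the product structure “these two Poisson processes are both product distributions”), ECCC TR13-111 p. 9] [cite: Canonne2020, §5.1 (“expanding the inner square”) and App. E.2] -/
theorem overlap (hδ0 : ∀ j, 0 ≤ δ j) (hδ : ∀ j c, δ j ≤ P (Sum.inl (j, c)))
    (z z' : Fin J → Bool) :
    ∑ x, P x * (1 + rel P δ z x) * (1 + rel P δ z' x) =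
      ∑ x, P x + ∑ j, sgn (z j) * sgn (z' j) * cc P δ j := by
  have hx : ∀ x, P x * (1 + rel P δ z x) * (1 + rel P δ z' x) =
      P x + P x * rel P δ z x + P x * rel P δ z' x + P x * rel P δ z x * rel P δ z' x := fun x => by
    ring
  simp_rw [hx, sum_add_distrib, sum_mul_rel hδ0 hδ, add_zero]
  congr 1
  rw [sum_pairSpace]
  simp only [rel, mul_zero, sum_const_zero, add_zero]
  refine sum_congr rfl fun j _ => ?_
  unfold cc
  rw [mul_div_mul_div_self, mul_div_mul_div_self]
  have hc : ∀ c : Bool, sgn (z j) * sgn c * δ j * (sgn (z' j) * sgn c * δ j) =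
      sgn (z j) * sgn (z' j) * δ j ^ 2 := by
    intro c
    have h := sgn_mul_sgn c
    calc sgn (z j) * sgn c * δ j * (sgn (z' j) * sgn c * δ j)
          = sgn (z j) * sgn (z' j) * δ j ^ 2 * (sgn c * sgn c) := by ring
      _ = sgn (z j) * sgn (z' j) * δ j ^ 2 := by rw [h, mul_one]
  rw [hc, hc]
  ring

end sums

/-! ### §2. Le Cam and the χ² step with a likelihood ratio -/

/-- **The χ² step against an arbitrary reference** (Cauchy–Schwarz): for a probability vector `p` and a
mixture written as `p·R` (`R` the likelihood ratio, `Σ pR = 1`), `‖p − pR‖₁² ≤ Σ_ω p(ω)R(ω)² − 1 = χ²(pR‖p)`.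
[cite: Canonne2020, §5.1 (“writing d_TV … dP/dQ … (the last inequality by Jensen)”) and App. E.2] -/
theorem l1_sq_le_sum_mul_sq_sub_one {Ω : Type*} [Fintype Ω] (p R : Ω → ℝ) (hp0 : ∀ ω, 0 ≤ p ω)
    (hp1 : ∑ ω, p ω = 1) (hR : ∑ ω, p ω * R ω = 1) :
    (∑ ω, |p ω - p ω * R ω|) ^ 2 ≤ ∑ ω, p ω * R ω ^ 2 - 1 := by
  have hCS := sum_mul_sq_le_sq_mul_sq (univ : Finset Ω) (fun ω => Real.sqrt (p ω))
    (fun ω => Real.sqrt (p ω) * |1 - R ω|)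
  have h1 : ∀ ω, Real.sqrt (p ω) * (Real.sqrt (p ω) * |1 - R ω|) = |p ω - p ω * R ω| := by
    intro ω
    rw [← mul_assoc, Real.mul_self_sqrt (hp0 ω)]
    rw [show p ω - p ω * R ω = p ω * (1 - R ω) by ring, abs_mul, abs_of_nonneg (hp0 ω)]
  have h2 : ∀ ω, Real.sqrt (p ω) ^ 2 = p ω := fun ω => Real.sq_sqrt (hp0 ω)
  have h3 : ∀ ω, (Real.sqrt (p ω) * |1 - R ω|) ^ 2 = p ω - 2 * (p ω * R ω) + p ω * R ω ^ 2 := by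
    intro ω
    rw [mul_pow, Real.sq_sqrt (hp0 ω), sq_abs]
    ring
  simp only [h1, h2, h3, sum_add_distrib, sum_sub_distrib, ← mul_sum, hp1, hR] at hCS
  linarith

section ingster

variable (P : PairSpace J R → ℝ) (δ : Fin J → ℝ)

/-- The likelihood ratio `Q_z^{⊗s}/P^{⊗s} = Π_k (1 + g_z(S_k))` of one perturbed product against the
reference product (no division needed). [cite: ValiantValiant2017, §3 Thm. 3 (product structure), ECCC TR13-111 p. 9] [cite: Canonne2020, App. E.2 (density of the mixture against the reference)] -/
def lr (z : Fin J → Bool) {s : ℕ} (S : Fin s → PairSpace J R) : ℝ := ∏ k, (1 + rel P δ z (S k))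

/-- The likelihood ratio of the uniform mixture `Q̄ = avg_z Q_z^{⊗s}` against `P^{⊗s}`. [cite: Canonne2020, §5.1 (the mixture 𝔼_{D∼D_no}[D^{⊗m}]) and App. E.2] -/
def ratio (s : ℕ) (S : Fin s → PairSpace J R) : ℝ := (∑ z : Fin J → Bool, lr P δ z S) / 2 ^ J

/-- The uniform mixture `Q̄(S) = avg_z Q_z^{⊗s}(S)` of the perturbed products. [cite: Canonne2020, §5.1 (“the expected distribution of a transcript of m samples from a randomly chosen no-distribution”)] -/
def mixW (s : ℕ) (S : Fin s → PairSpace J R) : ℝ :=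
  (∑ z : Fin J → Bool, prodW (pert P δ z) S) / 2 ^ J

/-- `Q_z^{⊗s} = P^{⊗s} · Π_k (1 + g_z(S_k))`. [cite: Canonne2020, App. E.2 (densities of product distributions)] -/
theorem prodW_pert (z : Fin J → Bool) {s : ℕ} (S : Fin s → PairSpace J R) :
    prodW (pert P δ z) S = prodW P S * lr P δ z S := by
  unfold prodW pert lr
  rw [← prod_mul_distrib]

/-- `Q̄ = P^{⊗s} · ratio`. [cite: Canonne2020, App. E.2] -/
theorem mixW_eq {s : ℕ} (S : Fin s → PairSpace J R) : mixW P δ s S = prodW P S * ratio P δ s S := by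
  unfold mixW ratio
  rw [mul_div_assoc', mul_sum]
  simp_rw [prodW_pert]

/-- `P^{⊗s} ≥ 0` (plumbing). [folklore] -/
private theorem prodW_nonneg' (hP0 : ∀ x, 0 ≤ P x) {s : ℕ} (S : Fin s → PairSpace J R) :
    0 ≤ prodW P S :=
  prod_nonneg fun k _ => hP0 (S k)

variable {P δ} [Fintype R]

/-- `Σ_S Q̄(S) = (Σ P)^s` (so `Q̄` is a probability vector on transcripts). [cite: Canonne2020, §5.1 (definition of the mixture)] -/
theorem sum_mixW (hδ0 : ∀ j, 0 ≤ δ j) (hδ : ∀ j c, δ j ≤ P (Sum.inl (j, c))) (s : ℕ) :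
    ∑ S : Fin s → PairSpace J R, mixW P δ s S = (∑ x, P x) ^ s := by
  unfold mixW
  rw [← sum_div, sum_comm]
  simp_rw [sum_prodW, sum_pert hδ0 hδ]
  rw [sum_const, card_univ, Fintype.card_fun, Fintype.card_bool, Fintype.card_fin, nsmul_eq_mul]
  push_cast
  field_simp

/-- `Σ_S P^{⊗s}(S)·ratio(S) = (Σ P)^s`. [cite: Canonne2020, App. E.2] -/
theorem sum_prodW_mul_ratio (hδ0 : ∀ j, 0 ≤ δ j) (hδ : ∀ j c, δ j ≤ P (Sum.inl (j, c))) (s : ℕ) :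
    ∑ S : Fin s → PairSpace J R, prodW P S * ratio P δ s S = (∑ x, P x) ^ s := by
  rw [← sum_mixW hδ0 hδ s]
  exact sum_congr rfl fun S _ => (mixW_eq P δ S).symm

/-- **Ingster's identity** for the paired family:
`Σ_S P^{⊗s}(S) ratio(S)² = 4^{−J} Σ_{z,z'} (Σ_x P(1+g_z)(1+g_{z'}))^s`. [cite: Canonne2020, §5.1 (“expanding the inner square and massaging the explicit yet discouraging expression”) and App. E.2] -/
theorem sum_prodW_mul_ratio_sq (s : ℕ) :
    ∑ S : Fin s → PairSpace J R, prodW P S * ratio P δ s S ^ 2 =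
      (∑ z : Fin J → Bool, ∑ z' : Fin J → Bool,
        (∑ x, P x * (1 + rel P δ z x) * (1 + rel P δ z' x)) ^ s) / (2 ^ J * 2 ^ J) := by
  have hS : ∀ S : Fin s → PairSpace J R, prodW P S * ratio P δ s S ^ 2 =
      (∑ z : Fin J → Bool, ∑ z' : Fin J → Bool,
        prodW (fun x => P x * (1 + rel P δ z x) * (1 + rel P δ z' x)) S) / (2 ^ J * 2 ^ J) := by
    intro S
    rw [ratio, div_pow, sq, sum_mul_sum, sq, mul_div_assoc', mul_sum]
    congr 1
    refine sum_congr rfl fun z _ => ?_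
    rw [mul_sum]
    refine sum_congr rfl fun z' _ => ?_
    unfold prodW lr
    rw [← prod_mul_distrib, ← prod_mul_distrib]
    exact prod_congr rfl fun k _ => by ring
  simp_rw [hS]
  rw [← sum_div, sum_comm]
  congr 1
  refine sum_congr rfl fun z _ => ?_
  rw [sum_comm]
  refine sum_congr rfl fun z' _ => ?_
  rw [sum_prodW]

/-- `(1 + x)^s ≤ e^{sx}` for `1 + x ≥ 0` (plumbing). [folklore] -/
private theorem one_add_pow_le_exp_mul' {x : ℝ} (hx : 0 ≤ 1 + x) (s : ℕ) :
    (1 + x) ^ s ≤ Real.exp (s * x) := by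
  calc (1 + x) ^ s ≤ (Real.exp x) ^ s := by
        apply pow_le_pow_left₀ hx
        have := Real.add_one_le_exp x; linarith
    _ = Real.exp (s * x) := by rw [← Real.exp_nat_mul]

/-- **The `cosh` computation with pair-dependent rates**:
`Σ_{z,z'} exp(Σ_j b_j σ(z_j)σ(z'_j)) = 2^J Π_j (2 cosh b_j)` (re-index `z' ↦ z ⊕ z'`, then factorise over the
pairs). [cite: Canonne2020, §5.1 (proof sketch of the Ω(√n/ε²) bound) and App. E.2] -/
theorem sum_sum_exp_sum_mul_sgn (b : Fin J → ℝ) :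
    ∑ z : Fin J → Bool, ∑ z' : Fin J → Bool, Real.exp (∑ j, b j * (sgn (z j) * sgn (z' j))) =
      2 ^ J * ∏ j, (2 * Real.cosh (b j)) := by
  have hinner : ∀ z : Fin J → Bool,
      ∑ z' : Fin J → Bool, Real.exp (∑ j, b j * (sgn (z j) * sgn (z' j))) =
        ∑ τ : Fin J → Bool, Real.exp (∑ j, b j * sgn (τ j)) := by
    intro z
    have hinv : Function.Involutive (fun z' : Fin J → Bool => fun j => xor (z j) (z' j)) := by
      intro z'; funext j; cases z j <;> simp
    refine Fintype.sum_equiv hinv.toPerm _ _ fun z' => ?_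
    simp only [Function.Involutive.coe_toPerm, sgn_xor_eq]
  simp_rw [hinner, sum_const, card_univ, Fintype.card_fun, Fintype.card_bool, Fintype.card_fin,
    nsmul_eq_mul]
  push_cast
  congr 1
  simp_rw [Real.exp_sum]
  rw [← Fintype.prod_sum (fun (j : Fin J) (c : Bool) => Real.exp (b j * sgn c))]
  refine prod_congr rfl fun j _ => ?_
  have ht : sgn true = -1 := by simp [sgn]
  have hf : sgn false = 1 := by simp [sgn]
  rw [Fintype.sum_bool, ht, hf, Real.cosh_eq]
  ring

/-- **The χ² bound**: `Σ_S P^{⊗s} ratio² ≤ Π_j cosh(s c_j) ≤ exp(s² Σ_j c_j²/2)` for a probability vector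
`P` (with `1 + x ≤ eˣ` on the nonnegative overlaps and `cosh b ≤ e^{b²/2}`) — the source's
`k (c₁ Σ_i ϵ_i⁴/p_i²)^{1/2}` bound on the distance between the two processes, here for `s` samples without
Poissonization. [cite: ValiantValiant2017, §3 Thm. 3 (“the statistical distance between a set of k samples drawn from p versus drawn from a random distribution of Q_ϵ is arbitrarily small” unless k ≳ (Σ ϵ_i⁴/p_i²)^{−1/2}), ECCC TR13-111 p. 9] [cite: Canonne2020, §5.1 (“one can finally obtain an upper bound of (e^{m²ε⁴/n} − 1)^{1/2}”)] -/
theorem sum_prodW_mul_ratio_sq_le (hP0 : ∀ x, 0 ≤ P x) (hP1 : ∑ x, P x = 1) (hδ0 : ∀ j, 0 ≤ δ j)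
    (hδ : ∀ j c, δ j ≤ P (Sum.inl (j, c))) (s : ℕ) :
    ∑ S : Fin s → PairSpace J R, prodW P S * ratio P δ s S ^ 2 ≤
      Real.exp ((s : ℝ) ^ 2 * (∑ j, cc P δ j ^ 2) / 2) := by
  rw [sum_prodW_mul_ratio_sq]
  have hstep : ∀ z z' : Fin J → Bool,
      (∑ x, P x * (1 + rel P δ z x) * (1 + rel P δ z' x)) ^ s ≤
        Real.exp (∑ j, ((s : ℝ) * cc P δ j) * (sgn (z j) * sgn (z' j))) := by
    intro z z'
    have hnn : 0 ≤ ∑ x, P x * (1 + rel P δ z x) * (1 + rel P δ z' x) :=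
      sum_nonneg fun x _ => mul_nonneg (mul_nonneg (hP0 x) (one_add_rel_nonneg hP0 hδ0 hδ z x))
        (one_add_rel_nonneg hP0 hδ0 hδ z' x)
    rw [overlap hδ0 hδ, hP1] at hnn ⊢
    refine (one_add_pow_le_exp_mul' hnn s).trans (le_of_eq ?_)
    congr 1
    rw [mul_sum]
    exact sum_congr rfl fun j _ => by ring
  have hJ : (0 : ℝ) < 2 ^ J * 2 ^ J := by positivity
  calc (∑ z : Fin J → Bool, ∑ z' : Fin J → Bool,
          (∑ x, P x * (1 + rel P δ z x) * (1 + rel P δ z' x)) ^ s) / (2 ^ J * 2 ^ J)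
        ≤ (∑ z : Fin J → Bool, ∑ z' : Fin J → Bool,
            Real.exp (∑ j, ((s : ℝ) * cc P δ j) * (sgn (z j) * sgn (z' j)))) / (2 ^ J * 2 ^ J) :=
          div_le_div_of_nonneg_right (sum_le_sum fun z _ => sum_le_sum fun z' _ => hstep z z') hJ.le
    _ = ∏ j, Real.cosh ((s : ℝ) * cc P δ j) := by
          rw [sum_sum_exp_sum_mul_sgn, prod_mul_distrib, prod_const, card_univ, Fintype.card_fin]
          field_simp
    _ ≤ ∏ j, Real.exp (((s : ℝ) * cc P δ j) ^ 2 / 2) :=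
          prod_le_prod (fun j _ => (Real.cosh_pos _).le) fun j _ => Real.cosh_le_exp_half_sq _
    _ = Real.exp ((s : ℝ) ^ 2 * (∑ j, cc P δ j ^ 2) / 2) := by
          rw [← Real.exp_sum]
          congr 1
          rw [mul_sum, sum_div]
          exact sum_congr rfl fun j _ => by ring

end ingster

/-! ### §3. Theorem 3 (paired form): indistinguishability, and its tester form -/

section main

variable [Fintype R] {P : PairSpace J R → ℝ} {δ : Fin J → ℝ}

/-- **Indistinguishability of the paired Valiant–Valiant mixture (Le Cam + Ingster).** For a probability
vector `P`, perturbation sizes `0 ≤ δ_j ≤ min(P(j,false), P(j,true))` and ANY `[0,1]`-valued acceptance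
function `φ` on transcripts of `s` samples,
`𝔼_{P^{⊗s}}[φ] − avg_z 𝔼_{Q_z^{⊗s}}[φ] ≤ ½ √(exp(s² Σ_j c_j²/2) − 1)`: “it takes at least
`c (Σ_i ϵ_i⁴/p_i²)^{−1/2}` samples to distinguish `p` from `Q_ϵ`”. [cite: ValiantValiant2017, §3 Thm. 3, ECCC TR13-111 p. 8–9] [cite: Canonne2020, App. E.2 Thm. E.7 (Le Cam's method) and Cor. E.8] -/
theorem accept_sub_avg_le (hP0 : ∀ x, 0 ≤ P x) (hP1 : ∑ x, P x = 1) (hδ0 : ∀ j, 0 ≤ δ j)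
    (hδ : ∀ j c, δ j ≤ P (Sum.inl (j, c))) {s : ℕ} (φ : (Fin s → PairSpace J R) → ℝ)
    (hφ0 : ∀ S, 0 ≤ φ S) (hφ1 : ∀ S, φ S ≤ 1) :
    accept P φ - (∑ z : Fin J → Bool, accept (pert P δ z) φ) / 2 ^ J ≤
      Real.sqrt (Real.exp ((s : ℝ) ^ 2 * (∑ j, cc P δ j ^ 2) / 2) - 1) / 2 := by
  have havg : (∑ z : Fin J → Bool, accept (pert P δ z) φ) / 2 ^ J =
      ∑ S, φ S * mixW P δ s S := by
    unfold accept mixW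
    rw [sum_comm, sum_div]
    refine sum_congr rfl fun S _ => ?_
    rw [← mul_sum, mul_div_assoc]
  rw [havg, accept]
  have hp1 : ∑ S : Fin s → PairSpace J R, prodW P S = 1 := by rw [sum_prodW, hP1, one_pow]
  have hm1 : ∑ S : Fin s → PairSpace J R, mixW P δ s S = 1 := by rw [sum_mixW hδ0 hδ, hP1, one_pow]
  have hLC := accept_sub_le_half_l1 (fun S => prodW P S) (mixW P δ s) (by rw [hp1, hm1]) φ hφ0 hφ1
  refine hLC.trans (div_le_div_of_nonneg_right ?_ (by norm_num))
  have hR1 : ∑ S : Fin s → PairSpace J R, prodW P S * ratio P δ s S = 1 := by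
    rw [sum_prodW_mul_ratio hδ0 hδ, hP1, one_pow]
  have hl1sq : (∑ S : Fin s → PairSpace J R, |prodW P S - mixW P δ s S|) ^ 2 ≤
      Real.exp ((s : ℝ) ^ 2 * (∑ j, cc P δ j ^ 2) / 2) - 1 := by
    simp_rw [mixW_eq]
    exact (l1_sq_le_sum_mul_sq_sub_one _ _ (prodW_nonneg' P hP0) hp1 hR1).trans
      (by linarith [sum_prodW_mul_ratio_sq_le hP0 hP1 hδ0 hδ s])
  have habs := Real.abs_le_sqrt hl1sq
  rwa [abs_of_nonneg (sum_nonneg fun S _ => abs_nonneg _)] at habs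

/-- `exp x ≤ 13/9` for `x ≤ 4/13` (numerical plumbing, from `exp x ≤ 1/(1 − x)`). [folklore] -/
private theorem exp_le_of_le' {x : ℝ} (hx : x ≤ 4 / 13) : Real.exp x ≤ 13 / 9 := by
  rcases le_or_gt 0 x with h0 | h0
  · calc Real.exp x ≤ 1 / (1 - x) := Real.exp_bound_div_one_sub_of_interval h0 (by linarith)
      _ ≤ 13 / 9 := by
          rw [div_le_div_iff₀ (by linarith) (by norm_num)]; linarith
  · have := Real.exp_lt_one_iff.2 h0
    linarith

/-- **Theorem 3, tester form (thresholds `2/3`, `1/3`).** If a `[0,1]`-valued test on `s` samples accepts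
`P` with probability `≥ 2/3` and accepts every `Q_z` with probability `< 1/3`, then `s² Σ_j c_j² > 8/13`:
“it takes at least `c (Σ_i ϵ_i⁴/p_i²)^{−1/2}` samples to distinguish `p` from `Q_ϵ` with success
probability `2/3`” — here `c_j² ≤ 4 δ_j⁴/min(P(j,·))²`, constant explicit. [cite: ValiantValiant2017, §3 Thm. 3, ECCC TR13-111 p. 8–9] [cite: Canonne2020, App. E.2 Cor. E.8] -/
theorem samples_sq_mul_sum_cc_sq_gt (hP0 : ∀ x, 0 ≤ P x) (hP1 : ∑ x, P x = 1) (hδ0 : ∀ j, 0 ≤ δ j)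
    (hδ : ∀ j c, δ j ≤ P (Sum.inl (j, c))) {s : ℕ} (φ : (Fin s → PairSpace J R) → ℝ)
    (hφ0 : ∀ S, 0 ≤ φ S) (hφ1 : ∀ S, φ S ≤ 1) (hcomplete : 2 / 3 ≤ accept P φ)
    (hsound : ∀ z, accept (pert P δ z) φ < 1 / 3) :
    8 / 13 < (s : ℝ) ^ 2 * ∑ j, cc P δ j ^ 2 := by
  have hmain := accept_sub_avg_le hP0 hP1 hδ0 hδ φ hφ0 hφ1
  have havg : (∑ z : Fin J → Bool, accept (pert P δ z) φ) / 2 ^ J < 1 / 3 := by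
    rw [div_lt_iff₀ (by positivity)]
    calc ∑ z : Fin J → Bool, accept (pert P δ z) φ < ∑ _z : Fin J → Bool, (1 / 3 : ℝ) :=
          sum_lt_sum_of_nonempty univ_nonempty fun z _ => hsound z
      _ = 1 / 3 * 2 ^ J := by
          rw [sum_const, card_univ, Fintype.card_fun, Fintype.card_bool, Fintype.card_fin,
            nsmul_eq_mul]
          push_cast
          ring
  set x := (s : ℝ) ^ 2 * (∑ j, cc P δ j ^ 2) / 2 with hx
  have hgt : 1 / 3 < Real.sqrt (Real.exp x - 1) / 2 := by linarith
  by_contra hle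
  push Not at hle
  have hxle : x ≤ 4 / 13 := by rw [hx]; linarith
  have hexp := exp_le_of_le' hxle
  have hsq : Real.sqrt (Real.exp x - 1) ≤ 2 / 3 :=
    calc Real.sqrt (Real.exp x - 1) ≤ Real.sqrt ((2 / 3) ^ 2) := Real.sqrt_le_sqrt (by linarith)
      _ = 2 / 3 := Real.sqrt_sq (by norm_num)
  linarith

end main


/-! ### §4. Corollary 1: the magnitudes `ϵ_i = min{p_i, α p_i^{2/3}}` -/

section weights

/-- Valiant–Valiant's perturbation magnitude `ϵ_i = min{p_i, α p_i^{2/3}}`. [cite: ValiantValiant2017, §3 Cor. 1 (“letting ϵ_i = min{p_i, αp_i^{2/3}}”), ECCC TR13-111 p. 10] -/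
def vvWeight (α p : ℝ) : ℝ := min p (α * p ^ (2 / 3 : ℝ))

/-- `ϵ_i ≤ p_i`. [cite: ValiantValiant2017, §3 Cor. 1, ECCC TR13-111 p. 10] -/
theorem vvWeight_le_self (α p : ℝ) : vvWeight α p ≤ p := min_le_left _ _

/-- `ϵ_i ≤ α p_i^{2/3}`. [cite: ValiantValiant2017, §3 Cor. 1, ECCC TR13-111 p. 10] -/
theorem vvWeight_le_mul_rpow (α p : ℝ) : vvWeight α p ≤ α * p ^ (2 / 3 : ℝ) := min_le_right _ _

/-- `ϵ_i ≥ 0` for `α, p_i ≥ 0`. [cite: ValiantValiant2017, §3 Cor. 1, ECCC TR13-111 p. 10] -/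
theorem vvWeight_nonneg {α p : ℝ} (hα : 0 ≤ α) (hp : 0 ≤ p) : 0 ≤ vvWeight α p :=
  le_min hp (mul_nonneg hα (Real.rpow_nonneg hp _))

/-- At `α = 0` the magnitude vanishes. [cite: ValiantValiant2017, §3 Cor. 1, ECCC TR13-111 p. 10] -/
theorem vvWeight_zero_left {p : ℝ} (hp : 0 ≤ p) : vvWeight 0 p = 0 := by
  unfold vvWeight
  rw [zero_mul]
  exact min_eq_right hp

/-- At `α = 1` the magnitude of a probability is the probability itself (`p ≤ p^{2/3}` on `[0,1]`).
[cite: ValiantValiant2017, §3 Cor. 1, ECCC TR13-111 p. 10] -/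
theorem vvWeight_one_left {p : ℝ} (hp0 : 0 ≤ p) (hp1 : p ≤ 1) : vvWeight 1 p = p := by
  unfold vvWeight
  rw [one_mul]
  apply min_eq_left
  rcases hp0.eq_or_lt with h | hpos
  · rw [← h, Real.zero_rpow (by norm_num)]
  · calc p = p ^ (1 : ℝ) := (Real.rpow_one p).symm
      _ ≤ p ^ (2 / 3 : ℝ) := Real.rpow_le_rpow_of_exponent_ge hpos hp1 (by norm_num)

/-- `ϵ_i` is monotone in `p_i` (both branches are): “since `p_i` are sorted in ascending order …”.
[cite: ValiantValiant2017, §3 Prop. 2 (proof), ECCC TR13-111 p. 10] -/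
theorem vvWeight_mono {α p q : ℝ} (hα : 0 ≤ α) (hp : 0 ≤ p) (hpq : p ≤ q) :
    vvWeight α p ≤ vvWeight α q :=
  min_le_min hpq (mul_le_mul_of_nonneg_left (Real.rpow_le_rpow hp hpq (by norm_num)) hα)

/-- `α ↦ ϵ_i(α)` is continuous (used to choose `α` with a prescribed total perturbation).
[cite: ValiantValiant2017, §3 Prop. 2 (“consider the value of α for which ½Σ_{i≠m} min{p_i, αp_i^{2/3}} = ϵ”), ECCC TR13-111 p. 10] -/
theorem continuous_vvWeight (p : ℝ) : Continuous fun α : ℝ => vvWeight α p :=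
  continuous_const.min (continuous_id.mul continuous_const)

/-- `(p^{2/3})³ = p²` (plumbing). [folklore] -/
private theorem rpow_two_thirds_pow_three {p : ℝ} (hp : 0 ≤ p) : (p ^ (2 / 3 : ℝ)) ^ 3 = p ^ 2 := by
  rw [← Real.rpow_natCast (p ^ (2 / 3 : ℝ)) 3, ← Real.rpow_mul hp]
  norm_num

/-- **The Corollary-1 estimate** `ϵ_i⁴/p_i² ≤ α³ ϵ_i` (“since the min of two quantities can only increase if
we replace one by a weighted geometric mean of both of them”: `min{p, αp^{2/3}}⁴/p² ≤ α³ min{p, αp^{2/3}}`).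
[cite: ValiantValiant2017, §3 Prop. 2 (proof, the bound (Σ min{…}⁴/p_i²)^{−1/2} ≥ (α³ Σ min{…})^{−1/2}), ECCC TR13-111 p. 10] -/
theorem vvWeight_pow_four_div_sq_le {α p : ℝ} (hα : 0 ≤ α) (hp : 0 ≤ p) :
    vvWeight α p ^ 4 / p ^ 2 ≤ α ^ 3 * vvWeight α p := by
  have hw0 := vvWeight_nonneg hα hp
  rcases hp.eq_or_lt with h | hp'
  · rw [← h]
    simp only [ne_eq, OfNat.ofNat_ne_zero, not_false_eq_true, zero_pow, div_zero]
    rw [← h] at hw0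
    exact mul_nonneg (pow_nonneg hα 3) hw0
  · have h3 : vvWeight α p ^ 3 ≤ α ^ 3 * p ^ 2 := by
      calc vvWeight α p ^ 3 ≤ (α * p ^ (2 / 3 : ℝ)) ^ 3 :=
            pow_le_pow_left₀ hw0 (vvWeight_le_mul_rpow α p) 3
        _ = α ^ 3 * p ^ 2 := by rw [mul_pow, rpow_two_thirds_pow_three hp]
    rw [div_le_iff₀ (by positivity)]
    calc vvWeight α p ^ 4 = vvWeight α p ^ 3 * vvWeight α p := by ring
      _ ≤ α ^ 3 * p ^ 2 * vvWeight α p := mul_le_mul_of_nonneg_right h3 hw0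
      _ = α ^ 3 * vvWeight α p * p ^ 2 := by ring

/-- **The monotonicity step of Proposition 2**: if the power branch is inactive at `p` (`p < αp^{2/3}`),
it is inactive at every `q ≤ p` (“the inequality `p_i ≤ αp_i^{2/3}` gets stronger for smaller `p_i`”), i.e.
`ϵ(q) = q`. [cite: ValiantValiant2017, §3 Prop. 2 (proof), ECCC TR13-111 p. 10] -/
theorem vvWeight_eq_self {α p q : ℝ} (hq : 0 ≤ q) (hqp : q ≤ p) (hlt : p < α * p ^ (2 / 3 : ℝ)) :
    vvWeight α q = q := by
  unfold vvWeight
  apply min_eq_left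
  rcases hq.eq_or_lt with h | hq'
  · rw [← h, Real.zero_rpow (by norm_num), mul_zero]
  · have hp' : 0 < p := lt_of_lt_of_le hq' hqp
    have h23p : 0 < p ^ (2 / 3 : ℝ) := Real.rpow_pos_of_pos hp' _
    have h13 : p ^ (1 / 3 : ℝ) < α := by
      have h := (div_lt_iff₀ h23p).2 hlt
      have heq : p / p ^ (2 / 3 : ℝ) = p ^ (1 / 3 : ℝ) := by
        rw [show (1 / 3 : ℝ) = 1 - 2 / 3 by norm_num, Real.rpow_sub hp', Real.rpow_one]
      rwa [heq] at h
    have hq13 : q ^ (1 / 3 : ℝ) ≤ p ^ (1 / 3 : ℝ) := Real.rpow_le_rpow hq hqp (by norm_num)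
    calc q = q ^ (1 / 3 : ℝ) * q ^ (2 / 3 : ℝ) := by
          rw [← Real.rpow_add hq']; norm_num
      _ ≤ α * q ^ (2 / 3 : ℝ) :=
          mul_le_mul_of_nonneg_right (hq13.trans h13.le) (Real.rpow_nonneg hq _)

end weights

/-! ### §5. Proposition 2 on an arbitrary finite sample space, in enumerated form

The sample space is enumerated in ascending order of probability, `p_0 ≤ p_1 ≤ ⋯ ≤ p_{n−1}` (`n ≥ 2`;
`p_{n−1}` plays the source's `p_m = max_i p_i`); consecutive elements are PAIRED — `(p_0,p_1), (p_2,p_3), …`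
for even `n`, and `p_0` left alone, `(p_1,p_2), (p_3,p_4), …` for odd `n` — and pair `j` is perturbed by
`∓δ_j`, `δ_j = ϵ(smaller member)`.  The source's index `s` (“the largest integer such that `Σ_{i<s} p_i ≤ ϵ`”)
is our `t + 1` with the mass condition at `2ϵ` (the threshold actually used by the source's proof, which sets
`½ Σ_{i≠m} min{p_i, αp_i^{2/3}} = ϵ`; Hangleiter et al. restate the bound with `‖P^{−max}_{−2ϵ}‖_{2/3}`
accordingly). -/

section pairing

/-- The enumeration of the pair space `(Fin J × Bool) ⊕ Fin r` by `Fin (r + 2J)`: the `r` unpaired points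
first, then pair `j` at positions `r + 2j` (`false`) and `r + 2j + 1` (`true`). [folklore] -/
def pairIdx (J r : ℕ) : PairSpace J (Fin r) ≃ Fin (r + J * 2) :=
  ((Equiv.sumCongr ((Equiv.prodCongr (Equiv.refl (Fin J)) finTwoEquiv.symm).trans finProdFinEquiv)
      (Equiv.refl (Fin r))).trans (Equiv.sumComm _ _)).trans finSumFinEquiv

/-- Position of the smaller point of pair `j`. [folklore] -/
private theorem pairIdx_inl_false (J r : ℕ) (j : Fin J) :
    ((pairIdx J r) (Sum.inl (j, false))).val = r + 2 * j := by
  simp [pairIdx, finTwoEquiv, finSumFinEquiv, mul_comm]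

/-- Position of the larger point of pair `j`. [folklore] -/
private theorem pairIdx_inl_true (J r : ℕ) (j : Fin J) :
    ((pairIdx J r) (Sum.inl (j, true))).val = r + 2 * j + 1 := by
  simp [pairIdx, finTwoEquiv, finSumFinEquiv, mul_comm]
  ring

/-- Position of an unpaired point. [folklore] -/
private theorem pairIdx_inr (J r : ℕ) (i : Fin r) : ((pairIdx J r) (Sum.inr i)).val = i := by
  simp [pairIdx, finSumFinEquiv]

/-- A shifted comparison of sums (plumbing): if `g_j ≤ δ_{j+1}` whenever `j + 1 < J` and `g_j ≤ 0` otherwise,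
then `Σ g ≤ Σ δ` for `δ ≥ 0`. [folklore] -/
private theorem sum_le_sum_shift {J : ℕ} (δ g : Fin J → ℝ) (hδ : ∀ j, 0 ≤ δ j)
    (hg : ∀ (j : Fin J) (h : j.val + 1 < J), g j ≤ δ ⟨j.val + 1, h⟩)
    (hg' : ∀ j : Fin J, ¬ (j.val + 1 < J) → g j ≤ 0) : ∑ j, g j ≤ ∑ j, δ j := by
  cases J with
  | zero => simp
  | succ J' =>
    rw [Fin.sum_univ_castSucc, Fin.sum_univ_succ]
    have h1 : ∑ i : Fin J', g i.castSucc ≤ ∑ i : Fin J', δ i.succ := by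
      refine sum_le_sum fun i _ => ?_
      have hi : (i.castSucc : Fin (J' + 1)).val + 1 < J' + 1 := by simp
      have := hg i.castSucc hi
      have heq : (⟨(i.castSucc : Fin (J' + 1)).val + 1, hi⟩ : Fin (J' + 1)) = i.succ := by
        ext; simp
      rw [heq] at this
      exact this
    have h2 : g (Fin.last J') ≤ 0 := hg' _ (by simp)
    have h3 := hδ 0
    linarith

/-- **Acceptance probabilities transport along relabellings of the outcomes** (plumbing for the
reduction to the pair space). [folklore] -/
private theorem accept_comp_equiv {α β : Type*} [Fintype α] [Fintype β] (e : α ≃ β) (Q : β → ℝ) {s : ℕ}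
    (φ : (Fin s → β) → ℝ) : accept (Q ∘ e) (fun S => φ (e ∘ S)) = accept Q φ := by
  unfold accept prodW
  refine Fintype.sum_equiv ((Equiv.refl (Fin s)).arrowCongr e) _ _ fun S => ?_
  have hS : ((Equiv.refl (Fin s)).arrowCongr e) S = e ∘ S := by
    funext k; rfl
  rw [hS]
  rfl

end pairing

section enumerated

variable {ι : Type*} [Fintype ι]

/-- **Valiant–Valiant's instance-optimal lower bound (Theorem 1, lower half = Proposition 2), explicit
form.**  Let `P` be a probability vector on a finite sample space enumerated in ascending order,
`p_0 ≤ ⋯ ≤ p_{n−1}` (`n ≥ 2`), let `ϵ > 0`, and let `t ≤ n − 2` be an index with `Σ_{k≤t} p_k > 2ϵ` (so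
that `p_t, …, p_{n−2}` are entries of `P^{−max}_{−2ϵ}` — the largest entry removed and at most `2ϵ` of mass
trimmed from below).  If a `[0,1]`-valued test on `s` samples accepts `P` with probability `≥ 2/3` and
accepts every probability vector `Q` with `‖P − Q‖₁ > ϵ` with probability `< 1/3`, then
`(Σ_{t ≤ k ≤ n−2} p_k^{2/3})³ < 104 s² ϵ⁴`, i.e. `s > ‖(p_t,…,p_{n−2})‖_{2/3}/(√104 ϵ²)`: “no tester can
distinguish … `q = p` or `‖p − q‖₁ ≥ ϵ` with probability `≥ 2/3` when given a set of samples of size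
`c₂ ‖p^{−max}_{−ϵ}‖_{2/3}/ϵ²`.”  Proof: the source's `α` with `Σ_{i≠m} min{p_i, αp_i^{2/3}} = 2ϵ`
(intermediate value theorem), its observation that the power branch is active above the trimming index
(`α Σ_{k∈L} p_k^{2/3} ≤ 2ϵ`), the magnitudes `δ_j = min{p, αp^{2/3}}` of the smaller member of each
consecutive pair (so each `Q_z` is `≥ 4ϵ/3 > ϵ` far), Theorem 3 in the paired form above
(`s² Σ c_j² > 8/13` with `Σ c_j² ≤ 8ϵα³`). [cite: ValiantValiant2017, Thm. 1 (lower bound) = §3 Prop. 2 with Cor. 1 and Thm. 3, ECCC TR13-111 pp. 8–10; SIAM J. Comput. 46 (2017) 429–455] -/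
theorem vv_lower_bound_enum {n : ℕ} (P : ι → ℝ) (hP0 : ∀ i, 0 ≤ P i)
    (hP1 : ∑ i, P i = 1) (x : Fin n ≃ ι) (hmono : Monotone (P ∘ x)) {ε : ℝ} (hε : 0 < ε)
    {t : ℕ} (ht : t + 1 < n)
    (hheavy : 2 * ε < ∑ k ∈ univ.filter (fun k : Fin n => k.val ≤ t), P (x k))
    {s : ℕ} (φ : (Fin s → ι) → ℝ) (hφ0 : ∀ S, 0 ≤ φ S) (hφ1 : ∀ S, φ S ≤ 1)
    (hcomplete : 2 / 3 ≤ accept P φ)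
    (hsound : ∀ Q : ι → ℝ, (∀ i, 0 ≤ Q i) → ∑ i, Q i = 1 → ε < ∑ i, |P i - Q i| →
      accept Q φ < 1 / 3) :
    (∑ k ∈ univ.filter (fun k : Fin n => t ≤ k.val ∧ k.val + 1 < n), P (x k) ^ (2 / 3 : ℝ)) ^ 3
      < 104 * (s : ℝ) ^ 2 * ε ^ 4 := by
  classical
  -- the enumerated probabilities
  set p : Fin n → ℝ := fun k => P (x k) with hp
  have hp0 : ∀ k, 0 ≤ p k := fun k => hP0 _
  have hpmono : Monotone p := hmono
  have hp_le_one : ∀ k, p k ≤ 1 := by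
    intro k
    have : P (x k) ≤ ∑ i, P i := single_le_sum (fun i _ => hP0 i) (mem_univ (x k))
    rw [hP1] at this
    exact this
  -- the index sets: A = all but the last (the source's i ≠ m), T = the heavy prefix, L = the survivors
  set A : Finset (Fin n) := univ.filter (fun k : Fin n => k.val + 1 < n) with hA
  set L : Finset (Fin n) := univ.filter (fun k : Fin n => t ≤ k.val ∧ k.val + 1 < n) with hL
  set T : Finset (Fin n) := univ.filter (fun k : Fin n => k.val ≤ t) with hT
  have hmemA : ∀ k : Fin n, k ∈ A ↔ k.val + 1 < n := fun k => by simp [hA]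
  have hmemL : ∀ k : Fin n, k ∈ L ↔ t ≤ k.val ∧ k.val + 1 < n := fun k => by simp [hL]
  have hmemT : ∀ k : Fin n, k ∈ T ↔ k.val ≤ t := fun k => by simp [hT]
  have hTA : T ⊆ A := fun k hk => (hmemA k).2 (by have := (hmemT k).1 hk; omega)
  have hLA : L ⊆ A := fun k hk => (hmemA k).2 ((hmemL k).1 hk).2
  -- the total perturbation as a function of α, and the choice of α (intermediate value theorem)
  set F : ℝ → ℝ := fun α => ∑ k ∈ A, vvWeight α (p k) with hF
  have hFcont : Continuous F := continuous_finsetSum _ fun k _ => continuous_vvWeight (p k)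
  have hF0 : F 0 = 0 := by
    rw [hF]
    exact sum_eq_zero fun k _ => vvWeight_zero_left (hp0 k)
  have hF1 : F 1 = ∑ k ∈ A, p k := sum_congr rfl fun k _ => vvWeight_one_left (hp0 k) (hp_le_one k)
  have hF1_ge : 2 * ε ≤ F 1 := by
    rw [hF1]
    exact hheavy.le.trans (sum_le_sum_of_subset_of_nonneg hTA fun k _ _ => hp0 k)
  obtain ⟨α, ⟨hα0, -⟩, hFα⟩ : ∃ α ∈ Set.Icc (0 : ℝ) 1, F α = 2 * ε := by
    have hivt := intermediate_value_Icc (zero_le_one (α := ℝ)) hFcont.continuousOn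
    have hmem : 2 * ε ∈ Set.Icc (F 0) (F 1) := ⟨by rw [hF0]; linarith, hF1_ge⟩
    exact hivt hmem
  -- on the survivors the power branch is active (the source's "for i ≥ s the min is never p_i")
  have hLpow : ∀ k ∈ L, α * p k ^ (2 / 3 : ℝ) ≤ p k := by
    intro k hk
    by_contra hlt
    push Not at hlt
    have hkL : t ≤ k.val := ((hmemL k).1 hk).1
    have hTle : ∑ i ∈ T, p i ≤ F α := by
      calc ∑ i ∈ T, p i = ∑ i ∈ T, vvWeight α (p i) := by
            refine sum_congr rfl fun i hi => ?_
            have hit : i.val ≤ t := (hmemT i).1 hi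
            have hik : p i ≤ p k := hpmono (Fin.le_iff_val_le_val.2 (hit.trans hkL))
            exact (vvWeight_eq_self (hp0 i) hik hlt).symm
        _ ≤ F α := sum_le_sum_of_subset_of_nonneg hTA fun i _ _ => vvWeight_nonneg hα0 (hp0 i)
    linarith
  have hLw : ∀ k ∈ L, vvWeight α (p k) = α * p k ^ (2 / 3 : ℝ) := fun k hk =>
    min_eq_right (hLpow k hk)
  -- hence α Σ_{k∈L} p_k^{2/3} ≤ 2ε
  set SL := ∑ k ∈ L, p k ^ (2 / 3 : ℝ) with hSL
  have hSL0 : 0 ≤ SL := sum_nonneg fun k _ => Real.rpow_nonneg (hp0 k) _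
  have hαSL : α * SL ≤ 2 * ε := by
    calc α * SL = ∑ k ∈ L, vvWeight α (p k) := by
          rw [hSL, mul_sum]
          exact sum_congr rfl fun k hk => (hLw k hk).symm
      _ ≤ F α := sum_le_sum_of_subset_of_nonneg hLA fun i _ _ => vvWeight_nonneg hα0 (hp0 i)
      _ = 2 * ε := hFα
  -- the pairing of consecutive elements
  set r := n % 2 with hr
  set J := n / 2 with hJ
  have hrJ : r + J * 2 = n := by omega
  have hJpos : 0 < J := by omega
  have hr1 : r ≤ 1 := by omega
  set idx : PairSpace J (Fin r) ≃ Fin n := (pairIdx J r).trans (finCongr hrJ) with hidx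
  have hidx_f : ∀ j : Fin J, (idx (Sum.inl (j, false))).val = r + 2 * j := fun j => by
    simp [hidx, pairIdx_inl_false]
  have hidx_t : ∀ j : Fin J, (idx (Sum.inl (j, true))).val = r + 2 * j + 1 := fun j => by
    simp [hidx, pairIdx_inl_true]
  have hidx_r : ∀ i : Fin r, (idx (Sum.inr i)).val = i := fun i => by
    simp [hidx, pairIdx_inr]
  set e : PairSpace J (Fin r) ≃ ι := idx.trans x with he
  set P' : PairSpace J (Fin r) → ℝ := P ∘ e with hP'
  have hP'eq : ∀ y, P' y = p (idx y) := fun y => rfl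
  have hP'0 : ∀ y, 0 ≤ P' y := fun y => hP0 _
  have hP'1 : ∑ y, P' y = 1 := by
    rw [← hP1]
    exact Fintype.sum_equiv e _ _ fun y => rfl
  have hft : ∀ j, P' (Sum.inl (j, false)) ≤ P' (Sum.inl (j, true)) := by
    intro j
    rw [hP'eq, hP'eq]
    apply hpmono
    rw [Fin.le_iff_val_le_val, hidx_f, hidx_t]
    omega
  -- the magnitudes δ_j = ε(smaller member of pair j)
  set δ : Fin J → ℝ := fun j => vvWeight α (P' (Sum.inl (j, false))) with hδdef
  have hδ0 : ∀ j, 0 ≤ δ j := fun j => vvWeight_nonneg hα0 (hP'0 _)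
  have hδ : ∀ j c, δ j ≤ P' (Sum.inl (j, c)) := by
    intro j c
    cases c
    · exact vvWeight_le_self _ _
    · exact (vvWeight_le_self _ _).trans (hft j)
  -- F α split along the pairing: the smaller members contribute Σ δ, the rest is nonnegative and ≤ 2 Σ δ
  set G : Fin n → ℝ := fun k => if k.val + 1 < n then vvWeight α (p k) else 0 with hG
  have hG0 : ∀ k, 0 ≤ G k := fun k => by
    simp only [hG]
    split_ifs
    · exact vvWeight_nonneg hα0 (hp0 k)
    · exact le_rfl
  have hFG : F α = ∑ j : Fin J, (G (idx (Sum.inl (j, false))) + G (idx (Sum.inl (j, true))))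
      + ∑ i : Fin r, G (idx (Sum.inr i)) := by
    have h1 : F α = ∑ k, G k := by
      rw [hF]
      dsimp only
      rw [hA, sum_filter]
    rw [h1, ← sum_pairSpace (fun y => G (idx y))]
    exact (Fintype.sum_equiv idx _ _ fun y => rfl).symm
  have hGf : ∀ j : Fin J, G (idx (Sum.inl (j, false))) = δ j := by
    intro j
    have hcond : (idx (Sum.inl (j, false))).val + 1 < n := by rw [hidx_f]; omega
    simp only [hG, hcond, if_true]
    rfl
  have hGt_le : ∑ j : Fin J, G (idx (Sum.inl (j, true))) ≤ ∑ j, δ j := by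
    refine sum_le_sum_shift δ _ hδ0 ?_ ?_
    · intro j hj
      have hle : G (idx (Sum.inl (j, true))) ≤ vvWeight α (p (idx (Sum.inl (j, true)))) := by
        simp only [hG]
        split_ifs
        · exact le_rfl
        · exact vvWeight_nonneg hα0 (hp0 _)
      refine hle.trans ?_
      show vvWeight α (p (idx (Sum.inl (j, true)))) ≤ vvWeight α (p (idx (Sum.inl (⟨j.val + 1, hj⟩, false))))
      apply vvWeight_mono hα0 (hp0 _)
      apply hpmono
      rw [Fin.le_iff_val_le_val, hidx_t, hidx_f]
      simp only
      omega
    · intro j hj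
      have hcond : ¬ ((idx (Sum.inl (j, true))).val + 1 < n) := by rw [hidx_t]; omega
      simp only [hG, hcond, if_false]
      exact le_rfl
  have hGr_le : ∑ i : Fin r, G (idx (Sum.inr i)) ≤ ∑ j, δ j := by
    have hle : ∀ i : Fin r, G (idx (Sum.inr i)) ≤ δ ⟨0, hJpos⟩ := by
      intro i
      have h1 : G (idx (Sum.inr i)) ≤ vvWeight α (p (idx (Sum.inr i))) := by
        simp only [hG]
        split_ifs
        · exact le_rfl
        · exact vvWeight_nonneg hα0 (hp0 _)
      refine h1.trans ?_
      show vvWeight α (p (idx (Sum.inr i))) ≤ vvWeight α (p (idx (Sum.inl (⟨0, hJpos⟩, false))))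
      apply vvWeight_mono hα0 (hp0 _)
      apply hpmono
      rw [Fin.le_iff_val_le_val, hidx_r, hidx_f]
      simp only
      omega
    calc ∑ i : Fin r, G (idx (Sum.inr i)) ≤ ∑ _i : Fin r, δ ⟨0, hJpos⟩ := sum_le_sum fun i _ => hle i
      _ = r * δ ⟨0, hJpos⟩ := by simp
      _ ≤ 1 * δ ⟨0, hJpos⟩ := by
          apply mul_le_mul_of_nonneg_right _ (hδ0 _)
          exact_mod_cast hr1
      _ = δ ⟨0, hJpos⟩ := one_mul _
      _ ≤ ∑ j, δ j := single_le_sum (fun j _ => hδ0 j) (mem_univ _)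
  have hδsum_le : ∑ j, δ j ≤ 2 * ε := by
    rw [← hFα, hFG, sum_add_distrib]
    simp_rw [hGf]
    have h1 : 0 ≤ ∑ j : Fin J, G (idx (Sum.inl (j, true))) := sum_nonneg fun j _ => hG0 _
    have h2 : 0 ≤ ∑ i : Fin r, G (idx (Sum.inr i)) := sum_nonneg fun i _ => hG0 _
    linarith
  have hF_le : 2 * ε ≤ 3 * ∑ j, δ j := by
    rw [← hFα, hFG, sum_add_distrib]
    simp_rw [hGf]
    linarith
  -- transport the test to the pair space and apply Theorem 3 (paired, tester form)
  set φ' : (Fin s → PairSpace J (Fin r)) → ℝ := fun S => φ (e ∘ S) with hφ'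
  have hcomplete' : 2 / 3 ≤ accept P' φ' := by
    rw [hP', hφ', accept_comp_equiv e P φ]
    exact hcomplete
  have hsound' : ∀ z, accept (pert P' δ z) φ' < 1 / 3 := by
    intro z
    set Q : ι → ℝ := pert P' δ z ∘ e.symm with hQ
    have hQe : pert P' δ z = Q ∘ e := by
      funext y
      simp [hQ]
    rw [hQe, hφ', accept_comp_equiv e Q φ]
    refine hsound Q (fun i => pert_nonneg hP'0 hδ0 hδ z _) ?_ ?_
    · calc ∑ i, Q i = ∑ y, pert P' δ z y := (Fintype.sum_equiv e _ _ fun y => by simp [hQ]).symm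
        _ = 1 := by rw [sum_pert hδ0 hδ, hP'1]
    · calc ε < 2 * ∑ j, δ j := by linarith
        _ = ∑ y, |pert P' δ z y - P' y| := (l1_pert hδ0 hδ z).symm
        _ = ∑ i, |P i - Q i| := by
            refine Fintype.sum_equiv e _ _ fun y => ?_
            rw [abs_sub_comm]
            simp [hQ, hP']
  have h813 := samples_sq_mul_sum_cc_sq_gt hP'0 hP'1 hδ0 hδ φ' (fun S => hφ0 _) (fun S => hφ1 _)
    hcomplete' hsound'
  -- Σ c_j² ≤ 4 α³ Σ δ_j ≤ 8 ε α³
  have hcc : ∀ j, cc P' δ j ^ 2 ≤ 4 * (α ^ 3 * δ j) := by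
    intro j
    have hpf0 : 0 ≤ P' (Sum.inl (j, false)) := hP'0 _
    have hcc0 : 0 ≤ cc P' δ j := by
      unfold cc
      exact add_nonneg (div_nonneg (sq_nonneg _) hpf0) (div_nonneg (sq_nonneg _) (hP'0 _))
    have hcc_le : cc P' δ j ≤ 2 * (δ j ^ 2 / P' (Sum.inl (j, false))) := by
      unfold cc
      rcases hpf0.eq_or_lt with h0 | hpos
      · have hδj : δ j = 0 := le_antisymm (h0 ▸ hδ j false) (hδ0 j)
        simp [hδj]
      · have : δ j ^ 2 / P' (Sum.inl (j, true)) ≤ δ j ^ 2 / P' (Sum.inl (j, false)) :=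
          div_le_div_of_nonneg_left (sq_nonneg _) hpos (hft j)
        linarith
    have hkey : δ j ^ 4 / P' (Sum.inl (j, false)) ^ 2 ≤ α ^ 3 * δ j :=
      vvWeight_pow_four_div_sq_le hα0 hpf0
    calc cc P' δ j ^ 2 ≤ (2 * (δ j ^ 2 / P' (Sum.inl (j, false)))) ^ 2 :=
          pow_le_pow_left₀ hcc0 hcc_le 2
      _ = 4 * (δ j ^ 4 / P' (Sum.inl (j, false)) ^ 2) := by ring
      _ ≤ 4 * (α ^ 3 * δ j) := by linarith
  have hsumcc : ∑ j, cc P' δ j ^ 2 ≤ 8 * ε * α ^ 3 := by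
    calc ∑ j, cc P' δ j ^ 2 ≤ ∑ j, 4 * (α ^ 3 * δ j) := sum_le_sum fun j _ => hcc j
      _ = 4 * α ^ 3 * ∑ j, δ j := by rw [mul_sum]; exact sum_congr rfl fun j _ => by ring
      _ ≤ 4 * α ^ 3 * (2 * ε) := mul_le_mul_of_nonneg_left hδsum_le (by positivity)
      _ = 8 * ε * α ^ 3 := by ring
  -- conclusion: (Σ_L p^{2/3})³ ≤ (2ε/α)³ < 104 s² ε⁴
  have hprod : 1 / 13 < (s : ℝ) ^ 2 * ε * α ^ 3 := by
    have := mul_le_mul_of_nonneg_left hsumcc (sq_nonneg (s : ℝ))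
    linarith
  have hαpos : 0 < α := by
    rcases hα0.eq_or_lt with h | h
    · rw [← h] at hprod; norm_num at hprod
    · exact h
  have hSLle : SL ≤ 2 * ε / α := by
    rw [le_div_iff₀ hαpos]; linarith
  have hSL3 : SL ^ 3 ≤ (2 * ε / α) ^ 3 := pow_le_pow_left₀ hSL0 hSLle 3
  have hα3 : 0 < α ^ 3 := pow_pos hαpos 3
  have hfin : (2 * ε / α) ^ 3 < 104 * (s : ℝ) ^ 2 * ε ^ 4 := by
    rw [div_pow, div_lt_iff₀ hα3]
    have h13 : 1 < 13 * ((s : ℝ) ^ 2 * ε * α ^ 3) := by linarith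
    have hε3 : (0 : ℝ) < 8 * ε ^ 3 := by positivity
    have := mul_lt_mul_of_pos_left h13 hε3
    nlinarith
  exact hSL3.trans_lt hfin

end enumerated

end IdentityTesting

end Literature.Probability.HypothesisTesting
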